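import Summits.RiemannHypothesis.RiemannHypothesis.Theses.WeilComb
import Summits.RiemannHypothesis.RiemannHypothesis.Theorems.WeilCombCombShapePositivityWindowCoreK11
import Summits.RiemannHypothesis.RiemannHypothesis.Theorems.WeilCombCombShapePositivityWindowCoercivityRankTwo
import Summits.RiemannHypothesis.RiemannHypothesis.Theorems.WeilCombCombShapePositivityStubGram
import Summits.RiemannHypothesis.RiemannHypothesis.Theorems.WeilCombCombShapePositivitySymbolRealEven
import Summits.RiemannHypothesis.RiemannHypothesis.Theorems.CombShapePositivity.Negative.WeilCombCombShapePositivityLoadBearing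
import Literature.NumberTheory.LFunctions.WeilExplicit
import Literature.NumberTheory.LFunctions.WeilMellinBounds
import Literature.NumberTheory.LFunctions.WeilArchimedeanMoments
import Literature.Analysis.SpecialFunctions.DigammaVerticalSeries

/-!
# `stub_windowCore` from the cone on the top cells; calibration by Weil positivity
(crux `WeilComb.CombShapePositivity`, item stmt-RiemannHypothesis-11229, line `Sketch`, skeleton v7 `86d35e56a923`)

Companion of `…WindowCoreK11.lean` (normal form, level monotonicity, `stub_windowCore ⟺ Theorem B ⟺ top cells`).
Notation as there; `D(a) = Σ_m Σ_{n ≤ M/m} Λ(n) ‖a(nm) − n^{-1/2} a(m)‖²` (Dirichlet energy), `ρ(u) = Re ψ(1/4 + iu/2)`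
(`reDigammaQuarter`), `archPlus(a) = (1/2π)∫|ĝ(1/2+iu)|² (ρ(u) − ρ(0)) du`, `F_ε = ∫ φ₀(u) cosh(εu/2) du`,
`C₂ = (F_ε² ε/‖φ₀‖₂²)(√((1 + log M)·M(M+1)/2) − M)`.

* `stub_windowCore_of_coneTopCells` — by the landed rank-two dichotomy `window_dichotomy_rank2` (p101483: off the cone
  `D(a) ≤ (log M + 1 + log π − ρ(0))‖a‖² − (ε/‖φ₀‖₂²) archPlus(a) + C₂‖a‖²` every window cell holds) and the top-cell
  reduction `stub_windowCore_iff_topCells`, the registered residual stub follows from the TOP cells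
  (`M ≥ 1`, `2ε(M+1) ≤ 1 < 2ε(M+2)`) restricted to that cone — the sharpest form of the residual in the line's vocabulary.
* `window_cell_one` — the level-one window cells are proved (Yoshida's `(log 2)/2` theorem in tree), so the open top
  cells are `M ≥ 2`.
* `window_cell_of_real`, `stub_windowCore_iff_topCells_real` — the Gram matrix is real symmetric (even symbol, p93312;
  Gram identity p87341), so real coefficient vectors suffice: the stub ⟺ top cells of level `M ≥ 2` over `b : ℕ → ℝ`.
* `stub_windowCore_of_weilPositivity`, `stub_windowCore_of_combShapePositivity` — calibration (the stub is a restriction of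
  Weil positivity / of the crux, read through the normal form).
-/

noncomputable section

-- the sub-problem path `RiemannHypothesis/RiemannHypothesis` (single-conjunct summit, D-0017) duplicates a namespace
set_option linter.dupNamespace false

open scoped BigOperators ComplexConjugate
open Complex MeasureTheory

namespace Summit.RiemannHypothesis.RiemannHypothesis.Theorems.WeilCombBohrFejer

open Literature.NumberTheory.LFunctions
open Literature.Analysis.SpecialFunctions (reDigammaQuarter)

/-! ## The cone on the top cells -/

/-- **The stub from the cone on the top cells.** By the landed rank-two dichotomy (`window_dichotomy_rank2`, p101483)
it suffices to prove the top cells (`M ≥ 1`, `2ε(M+1) ≤ 1 < 2ε(M+2)`) for coefficient vectors IN the cone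
`D(a) ≤ (log M + 1 + log π − ρ(0))‖a‖² − (ε/‖φ₀‖₂²)·archPlus(a) + C₂‖a‖²`. [folklore] -/
theorem stub_windowCore_of_coneTopCells
    (hcone : ∀ ε : ℝ, 0 < ε → ∀ (M : ℕ) (a : ℕ → ℂ), 1 ≤ M → 2 * ε * ((M : ℝ) + 1) ≤ 1 →
      1 < 2 * ε * ((M : ℝ) + 2) →
      (∑ m ∈ Finset.Icc 1 M, ∑ n ∈ Finset.Icc 1 (M / m),
          (ArithmeticFunction.vonMangoldt n : ℝ) * ‖a (n * m) - ((Real.sqrt n : ℂ))⁻¹ * a m‖ ^ 2 ≤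
        (Real.log M + 1 + Real.log Real.pi - reDigammaQuarter 0) * (∑ m ∈ Finset.Icc 1 M, ‖a m‖ ^ 2) -
            ε / weilNorm2Sq (fun u : ℝ => ((expNegInvGlue (1 - u ^ 2) : ℝ) : ℂ)) *
              (1 / (2 * Real.pi) * ∫ u : ℝ, ‖weilMellin (fun x : ℝ => ∑ m ∈ Finset.Icc 1 M,
                a m * ((ε : ℂ)⁻¹ * ((expNegInvGlue (1 - ((x - Real.log (m : ℝ)) / ε) ^ 2) : ℝ) : ℂ)))
                  (1 / 2 + u * I)‖ ^ 2 * (reDigammaQuarter u - reDigammaQuarter 0)) +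
          (∫ u : ℝ, expNegInvGlue (1 - u ^ 2) * Real.cosh (ε * u / 2)) ^ 2 * ε /
              weilNorm2Sq (fun u : ℝ => ((expNegInvGlue (1 - u ^ 2) : ℝ) : ℂ)) *
            (Real.sqrt ((1 + Real.log M) * ((M : ℝ) * ((M : ℝ) + 1) / 2)) - M) *
            (∑ m ∈ Finset.Icc 1 M, ‖a m‖ ^ 2)) →
      0 ≤ (weilQuadratic (fun x : ℝ => ∑ m ∈ Finset.Icc 1 M,
        a m * ((ε : ℂ)⁻¹ * ((expNegInvGlue (1 - ((x - Real.log (m : ℝ)) / ε) ^ 2) : ℝ) : ℂ)))).re) :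
    ∀ ε : ℝ, 0 < ε → ∀ (M : ℕ) (a : ℕ → ℂ), 1 ≤ M → 1 / 40 < ε * M →
      2 * ε * ((M : ℝ) + 1) ≤ 1 →
      ε⁻¹ * weilNorm2Sq (fun u : ℝ => ((expNegInvGlue (1 - u ^ 2) : ℝ) : ℂ)) *
          (2 * (∑ m ∈ Finset.Icc 1 M, ∑ n ∈ Finset.Icc 1 (M / m),
              ((ArithmeticFunction.vonMangoldt n : ℝ) : ℂ) / (Real.sqrt n : ℂ) * a (n * m) *
                conj (a m)).re
            + Real.log Real.pi * ∑ m ∈ Finset.Icc 1 M, ‖a m‖ ^ 2) ≤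
        2 * (weilMellin (fun t : ℝ => (ε : ℂ)⁻¹ * ((expNegInvGlue (1 - (t / ε) ^ 2) : ℝ) : ℂ)) 0 *
              conj (weilMellin (fun t : ℝ => (ε : ℂ)⁻¹ * ((expNegInvGlue (1 - (t / ε) ^ 2) : ℝ) : ℂ)) 1) *
            ((∑ m ∈ Finset.Icc 1 M, a m * ((Real.sqrt (m : ℝ) : ℝ) : ℂ)⁻¹) *
              conj (∑ m ∈ Finset.Icc 1 M, a m * ((Real.sqrt (m : ℝ) : ℝ) : ℂ)))).re
        + 1 / (2 * Real.pi) * ∫ t : ℝ,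
            ‖weilMellin (fun t : ℝ => (ε : ℂ)⁻¹ * ((expNegInvGlue (1 - (t / ε) ^ 2) : ℝ) : ℂ))
                (1 / 2 + t * I)‖ ^ 2 *
              ‖∑ m ∈ Finset.Icc 1 M, a m * cexp (t * I * (Real.log (m : ℝ) : ℂ))‖ ^ 2 *
              (Complex.digamma (1 / 4 + t / 2 * I)).re := by
  refine stub_windowCore_iff_topCells.2 fun ε hε M a hM hw htop => ?_
  rcases le_or_gt
      (∑ m ∈ Finset.Icc 1 M, ∑ n ∈ Finset.Icc 1 (M / m),
        (ArithmeticFunction.vonMangoldt n : ℝ) * ‖a (n * m) - ((Real.sqrt n : ℂ))⁻¹ * a m‖ ^ 2)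
      ((Real.log M + 1 + Real.log Real.pi - reDigammaQuarter 0) * (∑ m ∈ Finset.Icc 1 M, ‖a m‖ ^ 2) -
          ε / weilNorm2Sq (fun u : ℝ => ((expNegInvGlue (1 - u ^ 2) : ℝ) : ℂ)) *
            (1 / (2 * Real.pi) * ∫ u : ℝ, ‖weilMellin (fun x : ℝ => ∑ m ∈ Finset.Icc 1 M,
              a m * ((ε : ℂ)⁻¹ * ((expNegInvGlue (1 - ((x - Real.log (m : ℝ)) / ε) ^ 2) : ℝ) : ℂ)))
                (1 / 2 + u * I)‖ ^ 2 * (reDigammaQuarter u - reDigammaQuarter 0)) +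
        (∫ u : ℝ, expNegInvGlue (1 - u ^ 2) * Real.cosh (ε * u / 2)) ^ 2 * ε /
            weilNorm2Sq (fun u : ℝ => ((expNegInvGlue (1 - u ^ 2) : ℝ) : ℂ)) *
          (Real.sqrt ((1 + Real.log M) * ((M : ℝ) * ((M : ℝ) + 1) / 2)) - M) *
          (∑ m ∈ Finset.Icc 1 M, ‖a m‖ ^ 2)) with hin | hout
  · exact hcone ε hε M a hM hw htop hin
  · exact window_dichotomy_rank2 ε hε M a hM hw hout

/-! ## The proved frontier: level one -/

/-- **The level-one cells of the window are proved.** For `0 < ε` with `2ε·(1+1) ≤ 1` (so `ε ≤ 1/4 < (log 2)/2`) and every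
`a`, the single bump `a 1 · φ_ε` has `0 ≤ Re Q` — Yoshida's small-support positivity as discharged in the tree
(`weilPositivityOn_of_le_log_two_half`), through `weilComb_shapeComb_nonneg_of_weilPositivityOn` (support radius
`(log 1)/2 + |ε| = ε`). Hence the top cells that remain open in `stub_windowCore_iff_topCells` are those with `M ≥ 2`.
[folklore] -/
theorem window_cell_one {ε : ℝ} (hε : 0 < ε) (hw : 2 * ε * (((1 : ℕ) : ℝ) + 1) ≤ 1) (a : ℕ → ℂ) :
    0 ≤ (weilQuadratic (fun x : ℝ => ∑ m ∈ Finset.Icc 1 1,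
        a m * ((ε : ℂ)⁻¹ * ((expNegInvGlue (1 - ((x - Real.log (m : ℝ)) / ε) ^ 2) : ℝ) : ℂ)))).re := by
  have hlog2 : (0.6931471803 : ℝ) < Real.log 2 := Real.log_two_gt_d9
  have hε4 : ε ≤ 1 / 4 := by
    push_cast at hw
    linarith
  have hW : WeilPositivityOn (Real.log ((1 : ℕ) : ℝ) / 2 + |ε|) := by
    refine weilPositivityOn_of_le_log_two_half ?_
    rw [Nat.cast_one, Real.log_one, zero_div, zero_add, abs_of_pos hε]
    linarith
  exact Summit.RiemannHypothesis.RiemannHypothesis.Theorems.weilComb_shapeComb_nonneg_of_weilPositivityOn hW a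

/-! ## Real coefficient vectors suffice -/

/-- An antisymmetric double sum against a symmetric kernel vanishes. [folklore] -/
private theorem sum_sum_antisymm_eq_zero_K11 (s : Finset ℕ) (c w : ℕ → ℕ → ℂ)
    (hc : ∀ m m', c m' m = -c m m') (hw : ∀ m m', w m' m = w m m') :
    ∑ m ∈ s, ∑ m' ∈ s, c m m' * w m m' = 0 := by
  have h : ∑ m ∈ s, ∑ m' ∈ s, c m m' * w m m' = -(∑ m ∈ s, ∑ m' ∈ s, c m m' * w m m') := by
    calc ∑ m ∈ s, ∑ m' ∈ s, c m m' * w m m'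
        = ∑ m' ∈ s, ∑ m ∈ s, c m m' * w m m' := Finset.sum_comm
      _ = ∑ m' ∈ s, ∑ m ∈ s, (-(c m' m * w m' m)) := by
          refine Finset.sum_congr rfl fun m' _ => Finset.sum_congr rfl fun m _ => ?_
          rw [hc m' m, hw m' m]
          ring
      _ = -(∑ m' ∈ s, ∑ m ∈ s, c m' m * w m' m) := by
          simp only [Finset.sum_neg_distrib]
  linear_combination (1 / 2 : ℂ) * h

/-- **Real coefficient vectors suffice.** The comb Gram matrix `[W(τ_{log m − log m'} ψ_ε)]` is symmetric (the symbol
is even, `weilFunctional_translate_psi_real_even`), so by the Gram identity (`stub_gram`)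
`Q(g_a) = Q(g_{Re a}) + Q(g_{Im a})` for every complex coefficient vector `a`: positivity of the cell `(ε, M)` for all
REAL vectors gives it for all complex ones. [folklore] -/
theorem window_cell_of_real {ε : ℝ} (hε : 0 < ε) {M : ℕ}
    (h : ∀ b : ℕ → ℝ, 0 ≤ (weilQuadratic (fun x : ℝ => ∑ m ∈ Finset.Icc 1 M,
        ((b m : ℝ) : ℂ) * ((ε : ℂ)⁻¹ * ((expNegInvGlue (1 - ((x - Real.log (m : ℝ)) / ε) ^ 2) : ℝ) : ℂ)))).re)
    (a : ℕ → ℂ) :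
    0 ≤ (weilQuadratic (fun x : ℝ => ∑ m ∈ Finset.Icc 1 M,
        a m * ((ε : ℂ)⁻¹ * ((expNegInvGlue (1 - ((x - Real.log (m : ℝ)) / ε) ^ 2) : ℝ) : ℂ)))).re := by
  -- the symbol `w(m, m') = W(τ_{log m − log m'} ψ_ε)` and its symmetry
  set w : ℕ → ℕ → ℂ := fun m m' => weilFunctional (weilTranslate
      (weilConv (fun t : ℝ => (ε : ℂ)⁻¹ * ((expNegInvGlue (1 - (t / ε) ^ 2) : ℝ) : ℂ))
        (weilReflect (fun t : ℝ => (ε : ℂ)⁻¹ * ((expNegInvGlue (1 - (t / ε) ^ 2) : ℝ) : ℂ))))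
      (Real.log (m : ℝ) - Real.log (m' : ℝ))) with hw
  have hsymm : ∀ m m' : ℕ, w m' m = w m m' := by
    intro m m'
    simp only [hw]
    rw [← (weilFunctional_translate_psi_real_even ε hε (Real.log (m : ℝ) - Real.log (m' : ℝ))).2, neg_sub]
  -- the Gram identity for every coefficient vector
  have hgram : ∀ c : ℕ → ℂ, weilQuadratic (fun x : ℝ => ∑ m ∈ Finset.Icc 1 M,
        c m * ((ε : ℂ)⁻¹ * ((expNegInvGlue (1 - ((x - Real.log (m : ℝ)) / ε) ^ 2) : ℝ) : ℂ))) =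
      ∑ m ∈ Finset.Icc 1 M, ∑ m' ∈ Finset.Icc 1 M, c m * conj (c m') * w m m' :=
    fun c => stub_gram ε hε M c
  have hx := h (fun m => (a m).re)
  have hy := h (fun m => (a m).im)
  rw [hgram (fun m => (((a m).re : ℝ) : ℂ))] at hx
  rw [hgram (fun m => (((a m).im : ℝ) : ℂ))] at hy
  rw [hgram a]
  -- split `a = Re a + i Im a` entrywise
  have key : ∑ m ∈ Finset.Icc 1 M, ∑ m' ∈ Finset.Icc 1 M, a m * conj (a m') * w m m' =
      (∑ m ∈ Finset.Icc 1 M, ∑ m' ∈ Finset.Icc 1 M, (((a m).re : ℝ) : ℂ) * conj (((a m').re : ℝ) : ℂ) * w m m') +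
      (∑ m ∈ Finset.Icc 1 M, ∑ m' ∈ Finset.Icc 1 M, (((a m).im : ℝ) : ℂ) * conj (((a m').im : ℝ) : ℂ) * w m m') +
      I * (∑ m ∈ Finset.Icc 1 M, ∑ m' ∈ Finset.Icc 1 M,
        (((a m).im * (a m').re - (a m).re * (a m').im : ℝ) : ℂ) * w m m') := by
    rw [Finset.mul_sum, ← Finset.sum_add_distrib, ← Finset.sum_add_distrib]
    refine Finset.sum_congr rfl fun m _ => ?_
    rw [Finset.mul_sum, ← Finset.sum_add_distrib, ← Finset.sum_add_distrib]
    refine Finset.sum_congr rfl fun m' _ => ?_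
    have e : a m * conj (a m') =
        (((a m).re : ℝ) : ℂ) * conj (((a m').re : ℝ) : ℂ) + (((a m).im : ℝ) : ℂ) * conj (((a m').im : ℝ) : ℂ) +
          I * (((a m).im * (a m').re - (a m).re * (a m').im : ℝ) : ℂ) := by
      apply Complex.ext <;> simp
      ring
    rw [e]
    ring
  have hanti : ∑ m ∈ Finset.Icc 1 M, ∑ m' ∈ Finset.Icc 1 M,
      (((a m).im * (a m').re - (a m).re * (a m').im : ℝ) : ℂ) * w m m' = 0 :=
    sum_sum_antisymm_eq_zero_K11 (Finset.Icc 1 M)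
      (fun m m' => (((a m).im * (a m').re - (a m).re * (a m').im : ℝ) : ℂ)) w
      (fun m m' => by push_cast; ring) hsymm
  rw [key, hanti, mul_zero, add_zero, Complex.add_re]
  exact add_nonneg hx hy

/-- **`stub_windowCore` ⟺ the top cells of level `M ≥ 2` over REAL coefficient vectors.** (Level one is proved,
`window_cell_one`; real vectors suffice, `window_cell_of_real`.) [folklore] -/
theorem stub_windowCore_iff_topCells_real :
    (∀ ε : ℝ, 0 < ε → ∀ (M : ℕ) (a : ℕ → ℂ), 1 ≤ M → 1 / 40 < ε * M →
      2 * ε * ((M : ℝ) + 1) ≤ 1 →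
      ε⁻¹ * weilNorm2Sq (fun u : ℝ => ((expNegInvGlue (1 - u ^ 2) : ℝ) : ℂ)) *
          (2 * (∑ m ∈ Finset.Icc 1 M, ∑ n ∈ Finset.Icc 1 (M / m),
              ((ArithmeticFunction.vonMangoldt n : ℝ) : ℂ) / (Real.sqrt n : ℂ) * a (n * m) *
                conj (a m)).re
            + Real.log Real.pi * ∑ m ∈ Finset.Icc 1 M, ‖a m‖ ^ 2) ≤
        2 * (weilMellin (fun t : ℝ => (ε : ℂ)⁻¹ * ((expNegInvGlue (1 - (t / ε) ^ 2) : ℝ) : ℂ)) 0 *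
              conj (weilMellin (fun t : ℝ => (ε : ℂ)⁻¹ * ((expNegInvGlue (1 - (t / ε) ^ 2) : ℝ) : ℂ)) 1) *
            ((∑ m ∈ Finset.Icc 1 M, a m * ((Real.sqrt (m : ℝ) : ℝ) : ℂ)⁻¹) *
              conj (∑ m ∈ Finset.Icc 1 M, a m * ((Real.sqrt (m : ℝ) : ℝ) : ℂ)))).re
        + 1 / (2 * Real.pi) * ∫ t : ℝ,
            ‖weilMellin (fun t : ℝ => (ε : ℂ)⁻¹ * ((expNegInvGlue (1 - (t / ε) ^ 2) : ℝ) : ℂ))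
                (1 / 2 + t * I)‖ ^ 2 *
              ‖∑ m ∈ Finset.Icc 1 M, a m * cexp (t * I * (Real.log (m : ℝ) : ℂ))‖ ^ 2 *
              (Complex.digamma (1 / 4 + t / 2 * I)).re) ↔
    (∀ ε : ℝ, 0 < ε → ∀ (M : ℕ) (b : ℕ → ℝ), 2 ≤ M → 2 * ε * ((M : ℝ) + 1) ≤ 1 →
      1 < 2 * ε * ((M : ℝ) + 2) →
      0 ≤ (weilQuadratic (fun x : ℝ => ∑ m ∈ Finset.Icc 1 M,
        ((b m : ℝ) : ℂ) * ((ε : ℂ)⁻¹ * ((expNegInvGlue (1 - ((x - Real.log (m : ℝ)) / ε) ^ 2) : ℝ) : ℂ)))).re) := by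
  rw [stub_windowCore_iff_topCells]
  constructor
  · intro h ε hε M b hM hw htop
    exact h ε hε M (fun m => ((b m : ℝ) : ℂ)) (le_trans one_le_two hM) hw htop
  · intro h ε hε M a hM hw htop
    rcases Nat.lt_or_ge M 2 with hM1 | hM2
    · obtain rfl : M = 1 := by omega
      exact window_cell_one hε hw a
    · exact window_cell_of_real hε (fun b => h ε hε M b hM2 hw htop) a

/-! ## Calibration -/

/-- **Weil positivity ⟹ `stub_windowCore`** (each comb is a Weil test). [folklore] -/
theorem stub_windowCore_of_weilPositivity (hW : WeilPositivity) :
    ∀ ε : ℝ, 0 < ε → ∀ (M : ℕ) (a : ℕ → ℂ), 1 ≤ M → 1 / 40 < ε * M →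
      2 * ε * ((M : ℝ) + 1) ≤ 1 →
      ε⁻¹ * weilNorm2Sq (fun u : ℝ => ((expNegInvGlue (1 - u ^ 2) : ℝ) : ℂ)) *
          (2 * (∑ m ∈ Finset.Icc 1 M, ∑ n ∈ Finset.Icc 1 (M / m),
              ((ArithmeticFunction.vonMangoldt n : ℝ) : ℂ) / (Real.sqrt n : ℂ) * a (n * m) *
                conj (a m)).re
            + Real.log Real.pi * ∑ m ∈ Finset.Icc 1 M, ‖a m‖ ^ 2) ≤
        2 * (weilMellin (fun t : ℝ => (ε : ℂ)⁻¹ * ((expNegInvGlue (1 - (t / ε) ^ 2) : ℝ) : ℂ)) 0 *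
              conj (weilMellin (fun t : ℝ => (ε : ℂ)⁻¹ * ((expNegInvGlue (1 - (t / ε) ^ 2) : ℝ) : ℂ)) 1) *
            ((∑ m ∈ Finset.Icc 1 M, a m * ((Real.sqrt (m : ℝ) : ℝ) : ℂ)⁻¹) *
              conj (∑ m ∈ Finset.Icc 1 M, a m * ((Real.sqrt (m : ℝ) : ℝ) : ℂ)))).re
        + 1 / (2 * Real.pi) * ∫ t : ℝ,
            ‖weilMellin (fun t : ℝ => (ε : ℂ)⁻¹ * ((expNegInvGlue (1 - (t / ε) ^ 2) : ℝ) : ℂ))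
                (1 / 2 + t * I)‖ ^ 2 *
              ‖∑ m ∈ Finset.Icc 1 M, a m * cexp (t * I * (Real.log (m : ℝ) : ℂ))‖ ^ 2 *
              (Complex.digamma (1 / 4 + t / 2 * I)).re :=
  stub_windowCore_iff_band.2 fun ε _ M a _ _ _ =>
    hW _ (Summit.RiemannHypothesis.RiemannHypothesis.Theorems.weilComb_shapeComb_isWeilTest ε M a)
/-- **The crux ⟹ `stub_windowCore`** (the stub is a restriction of `CombShapePositivity`, read through the normal form).
[folklore] -/
theorem stub_windowCore_of_combShapePositivity
    (h : Summit.RiemannHypothesis.RiemannHypothesis.Theses.WeilComb.CombShapePositivity) :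
    ∀ ε : ℝ, 0 < ε → ∀ (M : ℕ) (a : ℕ → ℂ), 1 ≤ M → 1 / 40 < ε * M →
      2 * ε * ((M : ℝ) + 1) ≤ 1 →
      ε⁻¹ * weilNorm2Sq (fun u : ℝ => ((expNegInvGlue (1 - u ^ 2) : ℝ) : ℂ)) *
          (2 * (∑ m ∈ Finset.Icc 1 M, ∑ n ∈ Finset.Icc 1 (M / m),
              ((ArithmeticFunction.vonMangoldt n : ℝ) : ℂ) / (Real.sqrt n : ℂ) * a (n * m) *
                conj (a m)).re
            + Real.log Real.pi * ∑ m ∈ Finset.Icc 1 M, ‖a m‖ ^ 2) ≤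
        2 * (weilMellin (fun t : ℝ => (ε : ℂ)⁻¹ * ((expNegInvGlue (1 - (t / ε) ^ 2) : ℝ) : ℂ)) 0 *
              conj (weilMellin (fun t : ℝ => (ε : ℂ)⁻¹ * ((expNegInvGlue (1 - (t / ε) ^ 2) : ℝ) : ℂ)) 1) *
            ((∑ m ∈ Finset.Icc 1 M, a m * ((Real.sqrt (m : ℝ) : ℝ) : ℂ)⁻¹) *
              conj (∑ m ∈ Finset.Icc 1 M, a m * ((Real.sqrt (m : ℝ) : ℝ) : ℂ)))).re
        + 1 / (2 * Real.pi) * ∫ t : ℝ,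
            ‖weilMellin (fun t : ℝ => (ε : ℂ)⁻¹ * ((expNegInvGlue (1 - (t / ε) ^ 2) : ℝ) : ℂ))
                (1 / 2 + t * I)‖ ^ 2 *
              ‖∑ m ∈ Finset.Icc 1 M, a m * cexp (t * I * (Real.log (m : ℝ) : ℂ))‖ ^ 2 *
              (Complex.digamma (1 / 4 + t / 2 * I)).re :=
  stub_windowCore_iff_band.2 fun ε hε M a _ _ _ => h ε hε M a
end Summit.RiemannHypothesis.RiemannHypothesis.Theorems.WeilCombBohrFejer

end
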